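import Summits.BirchSwinnertonDyer.BirchSwinnertonDyer.Theorems.GoldfeldAllTwistsTwoConverseTwinInertSevenPartnerSelmer
import Summits.BirchSwinnertonDyer.BirchSwinnertonDyer.Theorems.GoldfeldAllTwistsTwoConverseTwinAdditiveInertTwistDescent
import HarnessLib

set_option linter.dupNamespace false -- namespace `…BirchSwinnertonDyer.BirchSwinnertonDyer…` is the cell's (D-0017 nested layout)
set_option autoImplicit false

/-!
# Twin″ (item 19140), 7-INERT half: the COMPLEMENTARITY LAW in the kernel (rank / `Ш[2]` level) — exactly one of the
# partner twists `49a1^{(ℓ)}`, `49a1^{(aℓ)}` of the auxiliary-prime road has rank `0` and `Ш[2] = 0`, according to `σ(ℓ)`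

Cell `bsd-goldfeld`, seat `bsd-goldfeld-s1p-c301` (prover, gen 13); `--supports stmt-BirchSwinnertonDyer-19140` (twin″) as a
HELPER; consumer of `…TwinInertSevenPartnerSelmer` (`S ⊆ {1,7}`, `S' ⊆ {1,−7}`) through the tree's
`two_pow_twoIsogenySelmerRank_add_eq` (`2^{dim S + dim S'} = 2^{rank+2}·#Ш(V₀)[Ξ]·#Ш(E)[Ξ]`, Silverman X.4.2/X.4.9) and seat c301
gen 2's transport lemmas (`smul_eq_twoTwoTorsionModel…`, `sha_inf_torsionBy_eq_bot_smul`). Statements (UNCONDITIONAL; `ℓ ≡ 5 (mod 8)`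
prime, `(−7/ℓ) = 1`; `σ(ℓ)` choice-free as before):
* `rank_eq_zero_and_sha_two_of_card_le_two` — the arithmetic step `#S ≤ 2 ∧ #S' ≤ 2 ⇒ rank = 0 ∧ Ш[2] = 0` for any
  `E = ⟨0, a, 0, b, 0⟩` with `b(a² − 4b) ≠ 0`;
* **`rank_eq_zero_and_sha_two_posTwist_of_symbol_neg`**: `σ(ℓ) = −1` ⇒ for EVERY model `W` of `49a1^{(ℓ)}`
  (`C • W = cm7.quadraticTwist ℓ`): `rank W(ℚ) = 0` and `Ш(W/ℚ)[2] = 0`;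
* **`rank_eq_zero_and_sha_two_auxTwist_of_symbol_pos`**: `σ(ℓ) = +1`, `a ≡ 1 (mod 8)` prime, `−7 ∉ 𝔽_a²`, `a ∉ 𝔽_ℓ²` ⇒ the
  same for every model of `49a1^{(aℓ)}`.
What this feeds (NOT done here, named facts of the route): Burungale–Tian's rank-`0` `2`-converse turns `rank = 0 ∧ Ш[2] = 0`
(`corank₂ Sel_{2^∞} = 0`) into `L(49a1^{(M)}, 1) ≠ 0`, and Burungale–Flach's BSD formula for rank-`0` CM curves then gives the
EXACT `2`-adic valuation `ord₂(L(49a1^{(M)},1)/Ω) = ord₂(∏c_p/#tors²)` (`= 1` for `M = ℓ`, `= 2` for `M = aℓ`) — the «individual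
`L`-value information» of the inert half (memo `HOME/INERT7-AUXPRIME-HORIZON.md` §2–§3; c201 K12PP-INERT7 §2c).

HONEST FRAMING: ranks and `Ш[2]` of two GOOD-reduction twists OUTSIDE the additive cell; nothing about the cell's curve
`49a1^{(−ℓ)}` beyond parts VIII / SplitSymbol; no case of twin″ or K12₂″ is decided; BSD is not proved by any of this.

References: Silverman, *AEC* (2009), Thm. X.4.2(a), Prop. X.4.9, III.3.1(b) [SilvermanAEC2009].
-/

noncomputable section

open scoped Classical

open WeierstrassCurve Literature.NumberTheory.EllipticCurves

namespace Summit.BirchSwinnertonDyer.BirchSwinnertonDyer.Theorems.GoldfeldGoodTwists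

/-! ## §1. `#S ≤ 2 ∧ #S' ≤ 2 ⇒ rank = 0 ∧ Ш[2] = 0` -/

/-- Arithmetic: `2^{r+2}·n = k ≤ 4` with `k ≠ 0`... precisely `k = 2^{r+2}(n₁n₂)`, `k ≤ 4`, `0 < k` force `r = 0`,
`n₁ = n₂ = 1`. [folklore] -/
private theorem rank_zero_arith {r n₁ n₂ k : ℕ} (hk : k = 2 ^ (r + 2) * (n₁ * n₂)) (hk4 : k ≤ 4) (hk0 : 0 < k) :
    r = 0 ∧ n₁ = 1 ∧ n₂ = 1 := by
  subst hk
  have hn : 0 < n₁ * n₂ := Nat.pos_of_mul_pos_left hk0 |> fun h => by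
    rcases Nat.eq_zero_or_pos (n₁ * n₂) with h0 | h0
    · rw [h0, mul_zero] at hk0; exact absurd hk0 (lt_irrefl 0)
    · exact h0
  have hr : r = 0 := by
    by_contra hr
    have h8 : 8 ≤ 2 ^ (r + 2) := by
      calc 8 = 2 ^ 3 := by norm_num
        _ ≤ 2 ^ (r + 2) := Nat.pow_le_pow_right two_pos (by omega)
    nlinarith
  subst hr
  have hprod : n₁ * n₂ = 1 := by
    norm_num at hk4
    omega
  exact ⟨rfl, Nat.eq_one_of_mul_eq_one_right hprod, Nat.eq_one_of_mul_eq_one_left hprod⟩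

/-- **`#S(a,b) ≤ 2` and `#S'(a,b) ≤ 2` ⇒ `rank E(ℚ) = 0` and `Ш(E/ℚ)[2] = 0`** for `E = ⟨0, a, 0, b, 0⟩`,
`b(a² − 4b) ≠ 0`: from `2^{dim S + dim S'} = 2^{rank+2}·#(Ш(V₀) ⊓ range)·#(Ш(E) ⊓ range)` both `Ξ`-parts vanish and
`forall_mem_sha_two_smul_eq_zero_of_halfModel` gives `Ш(E)[2] = 0`. [cite: SilvermanAEC2009, Thm. X.4.2(a) and Prop. X.4.9] -/
theorem rank_eq_zero_and_sha_two_of_card_le_two {a b : ℤ} (hab : b * (a ^ 2 - 4 * b) ≠ 0)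
    [hV₀ : (⟨0, -(a : ℚ) / 2, 0, ((a : ℚ) ^ 2 - 4 * b) / 16, 0⟩ : WeierstrassCurve ℚ).IsElliptic]
    [hE : (⟨0, (a : ℚ), 0, (b : ℚ), 0⟩ : WeierstrassCurve ℚ).IsElliptic]
    (hS : (twoIsogenySelmerGroup a b).card ≤ 2) (hS' : (twoIsogenySelmerGroup' a b).card ≤ 2) :
    (⟨0, (a : ℚ), 0, (b : ℚ), 0⟩ : WeierstrassCurve ℚ).mordellWeilRank = 0 ∧
      ∀ c ∈ (⟨0, (a : ℚ), 0, (b : ℚ), 0⟩ : WeierstrassCurve ℚ).sha, 2 • c = 0 → c = 0 := by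
  have key := two_pow_twoIsogenySelmerRank_add_eq hab
  have h4 : 2 ^ (twoIsogenySelmerRank a b + twoIsogenySelmerRank' a b) ≤ 4 := by
    rw [pow_add, two_pow_twoIsogenySelmerRank_eq_card hab, two_pow_twoIsogenySelmerRank'_eq_card hab]
    nlinarith [hS, hS', Nat.zero_le (twoIsogenySelmerGroup a b).card]
  obtain ⟨hr, h₁, h₂⟩ := rank_zero_arith key h4 (by positivity)
  exact ⟨hr, forall_mem_sha_two_smul_eq_zero_of_halfModel (AddSubgroup.eq_bot_of_card_eq _ h₁)
    (AddSubgroup.eq_bot_of_card_eq _ h₂)⟩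

/-- Transport of `rank = 0 ∧ Ш[2] = 0` from a model `E = C' • W` to `W` (rank and `Ш[2]` are isomorphism invariants:
`mordellWeilRank_variableChange_holds`, `sha_inf_torsionBy_eq_bot_smul`). [cite: SilvermanAEC2009, X.§4 and III.3.1(b)] -/
theorem rank_eq_zero_and_sha_two_of_smul_eq (W E : WeierstrassCurve ℚ) [W.IsElliptic] [E.IsElliptic]
    (C' : VariableChange ℚ) (hE : C' • W = E)
    (hdesc : E.mordellWeilRank = 0 ∧ ∀ c ∈ E.sha, 2 • c = 0 → c = 0) :
    W.mordellWeilRank = 0 ∧ ∀ c ∈ W.sha, 2 • c = 0 → c = 0 := by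
  obtain ⟨h1, h2⟩ := rank_le_one_and_sha_two_of_smul_eq W E C' hE
    ⟨by rw [hdesc.1]; exact zero_le_one, fun _ => hdesc.2⟩
  subst hE
  have hrk : (C' • W).mordellWeilRank = W.mordellWeilRank := by
    have h := mordellWeilRank_variableChange_holds W C'
    unfold mordellWeilRank_variableChange at h
    convert h using 2
  have hr0 : W.mordellWeilRank = 0 := hrk ▸ hdesc.1
  -- Ш[2]: through `Ш ⊓ H¹[2] = ⊥` for `C' • W` and `C'⁻¹ • (C' • W) = W`
  have h3 : ((C' • W).sha ⊓ AddSubgroup.torsionBy (C' • W).galH1 2 : AddSubgroup _) = ⊥ := by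
    refine eq_bot_iff.mpr fun c hc ↦ ?_
    rw [AddSubgroup.mem_inf] at hc
    exact AddSubgroup.mem_bot.mpr (hdesc.2 _ hc.1 ((AddSubgroup.torsionBy.nsmul_iff (n := 2)).mp hc.2))
  have h4 := sha_inf_torsionBy_eq_bot_smul (C' • W) C'⁻¹ 2 h3
  have transfer : ∀ {X Y : WeierstrassCurve ℚ} (_ : X = Y),
      (Y.sha ⊓ AddSubgroup.torsionBy Y.galH1 2 : AddSubgroup _) = ⊥ →
      ∀ c ∈ X.sha, 2 • c = 0 → c = 0 := by
    intro X Y h hY c hc hn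
    subst h
    have : c ∈ (X.sha ⊓ AddSubgroup.torsionBy X.galH1 2 : AddSubgroup _) :=
      AddSubgroup.mem_inf.mpr ⟨hc, (AddSubgroup.torsionBy.nsmul_iff (n := 2)).mpr hn⟩
    rw [hY] at this
    exact AddSubgroup.mem_bot.mp this
  exact ⟨hr0, transfer (inv_smul_smul C' W).symm h4⟩

/-! ## §2. The two partners -/

section Partners

variable {l : ℕ} [Fact l.Prime]

/-- `b(a² − 4b) = 112M²·(−7M²) ≠ 0` for the model `E_M`, `M ≠ 0`. [folklore] -/
theorem hab_posTwist {M : ℤ} (hM : M ≠ 0) : (112 * M ^ 2 : ℤ) * ((21 * M) ^ 2 - 4 * (112 * M ^ 2)) ≠ 0 := by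
  rw [show ((21 * M : ℤ) ^ 2 - 4 * (112 * M ^ 2)) = -7 * M ^ 2 by ring]
  exact mul_ne_zero (mul_ne_zero (by norm_num) (pow_ne_zero 2 hM)) (mul_ne_zero (by norm_num) (pow_ne_zero 2 hM))

/-- **`σ(ℓ) = −1` ⇒ `rank = 0` and `Ш[2] = 0` for the two-torsion model `E_ℓ : y² = x³ + 21ℓx² + 112ℓ²x`.**
[cite: SilvermanAEC2009, Thm. X.4.2(a) and Prop. X.4.9] -/
theorem rank_eq_zero_and_sha_two_twoTorsionModel_posTwist_of_symbol_neg (hl8 : l % 8 = 5)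
    (hl7 : legendreSym l (-7) = 1) (hσ : ∀ s : ZMod l, s ^ 2 = -7 → ¬ IsSquare (2 * (s - 21)))
    [hE : (⟨0, ((21 * (l : ℤ) : ℤ) : ℚ), 0, ((112 * (l : ℤ) ^ 2 : ℤ) : ℚ), 0⟩ : WeierstrassCurve ℚ).IsElliptic] :
    (⟨0, ((21 * (l : ℤ) : ℤ) : ℚ), 0, ((112 * (l : ℤ) ^ 2 : ℤ) : ℚ), 0⟩ : WeierstrassCurve ℚ).mordellWeilRank = 0 ∧
      ∀ c ∈ (⟨0, ((21 * (l : ℤ) : ℤ) : ℚ), 0, ((112 * (l : ℤ) ^ 2 : ℤ) : ℚ), 0⟩ : WeierstrassCurve ℚ).sha,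
        2 • c = 0 → c = 0 := by
  have hl : l.Prime := Fact.out
  have hab := hab_posTwist (M := (l : ℤ)) (by exact_mod_cast hl.ne_zero)
  haveI := isElliptic_halfModel hab
  obtain ⟨hS, hS'⟩ := selmer_posTwist_subset_of_symbol_neg hl8 hl7 hσ
  refine rank_eq_zero_and_sha_two_of_card_le_two hab ((Finset.card_le_card hS).trans (by simp)) ?_
  rw [twoIsogenySelmerGroup'_eq, show (-2 * (21 * (l : ℤ))) = -42 * l by ring,
    show ((21 * (l : ℤ)) ^ 2 - 4 * (112 * (l : ℤ) ^ 2)) = -7 * l ^ 2 by ring]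
  exact (Finset.card_le_card hS').trans (by simp)

/-- **`σ(ℓ) = −1` ⇒ `rank W(ℚ) = 0` and `Ш(W/ℚ)[2] = 0` for EVERY model `W` of `49a1^{(ℓ)}`** (`ℓ ≡ 5 (mod 8)` prime,
`(−7/ℓ) = 1`, `2(s−21) ∉ 𝔽_ℓ²` for all `s² = −7`). UNCONDITIONAL. [cite: SilvermanAEC2009, Thm. X.4.2(a), Prop. X.4.9, III.3.1(b)] -/
theorem rank_eq_zero_and_sha_two_posTwist_of_symbol_neg (hl8 : l % 8 = 5) (hl7 : legendreSym l (-7) = 1)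
    (hσ : ∀ s : ZMod l, s ^ 2 = -7 → ¬ IsSquare (2 * (s - 21))) (W : WeierstrassCurve ℚ) [W.IsElliptic]
    (C : VariableChange ℚ) (hC : C • W = cm7.quadraticTwist ((l : ℤ) : ℚ)) :
    W.mordellWeilRank = 0 ∧ ∀ c ∈ W.sha, 2 • c = 0 → c = 0 := by
  have hl : l.Prime := Fact.out
  haveI := isElliptic_mk_of_ne_zero (F := ℚ) (hab_posTwist (M := (l : ℤ)) (by exact_mod_cast hl.ne_zero))
  have hE := smul_eq_twoTorsionModel_of_smul_eq_quadraticTwist (l : ℤ) W C hC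
  exact rank_eq_zero_and_sha_two_of_smul_eq W _ _ hE
    (rank_eq_zero_and_sha_two_twoTorsionModel_posTwist_of_symbol_neg hl8 hl7 hσ)

variable {a : ℕ} [Fact a.Prime]

/-- **`σ(ℓ) = +1` ⇒ `rank = 0` and `Ш[2] = 0` for the two-torsion model `E_{aℓ}`** (`a ≡ 1 (mod 8)` prime, `−7 ∉ 𝔽_a²`,
`a ∉ 𝔽_ℓ²`). [cite: SilvermanAEC2009, Thm. X.4.2(a) and Prop. X.4.9] -/
theorem rank_eq_zero_and_sha_two_twoTorsionModel_auxTwist_of_symbol_pos (hl8 : l % 8 = 5)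
    (hl7 : legendreSym l (-7) = 1) (hσ : ∀ s : ZMod l, s ^ 2 = -7 → IsSquare (2 * (s - 21))) (ha8 : a % 8 = 1)
    (ha7 : ¬ IsSquare ((-7 : ℤ) : ZMod a)) (hal : ¬ IsSquare ((a : ℤ) : ZMod l))
    [hE : (⟨0, ((21 * ((a : ℤ) * l) : ℤ) : ℚ), 0, ((112 * ((a : ℤ) * l) ^ 2 : ℤ) : ℚ), 0⟩ : WeierstrassCurve ℚ).IsElliptic] :
    (⟨0, ((21 * ((a : ℤ) * l) : ℤ) : ℚ), 0, ((112 * ((a : ℤ) * l) ^ 2 : ℤ) : ℚ), 0⟩ :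
        WeierstrassCurve ℚ).mordellWeilRank = 0 ∧
      ∀ c ∈ (⟨0, ((21 * ((a : ℤ) * l) : ℤ) : ℚ), 0, ((112 * ((a : ℤ) * l) ^ 2 : ℤ) : ℚ), 0⟩ : WeierstrassCurve ℚ).sha,
        2 • c = 0 → c = 0 := by
  have hl : l.Prime := Fact.out
  have hap : a.Prime := Fact.out
  have hM : ((a : ℤ) * l) ≠ 0 := mul_ne_zero (by exact_mod_cast hap.ne_zero) (by exact_mod_cast hl.ne_zero)
  have hab := hab_posTwist hM
  haveI := isElliptic_halfModel hab
  obtain ⟨hS, hS'⟩ := selmer_auxTwist_subset_of_symbol_pos hl8 hl7 hσ ha8 ha7 hal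
  refine rank_eq_zero_and_sha_two_of_card_le_two hab ((Finset.card_le_card hS).trans (by simp)) ?_
  rw [twoIsogenySelmerGroup'_eq, show (-2 * (21 * ((a : ℤ) * l))) = -42 * (a * l) by ring,
    show ((21 * ((a : ℤ) * l)) ^ 2 - 4 * (112 * ((a : ℤ) * l) ^ 2)) = -7 * (a * l) ^ 2 by ring]
  exact (Finset.card_le_card hS').trans (by simp)

/-- **`σ(ℓ) = +1` ⇒ `rank W(ℚ) = 0` and `Ш(W/ℚ)[2] = 0` for EVERY model `W` of `49a1^{(aℓ)}`** (`a ≡ 1 (mod 8)` prime inert in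
`ℚ(√−7)` with `(a/ℓ) = −1`). UNCONDITIONAL. Together with `rank_eq_zero_and_sha_two_posTwist_of_symbol_neg`: for every prime
`ℓ ≡ 5 (mod 8)` split in `ℚ(√−7)` and every such `a`, exactly one of `49a1^{(ℓ)}`, `49a1^{(aℓ)}` is certified of rank `0` with
`Ш[2] = 0` by first descent — which one is decided by the split symbol `σ(ℓ)`. [cite: SilvermanAEC2009, Thm. X.4.2(a), Prop. X.4.9, III.3.1(b)] -/
theorem rank_eq_zero_and_sha_two_auxTwist_of_symbol_pos (hl8 : l % 8 = 5) (hl7 : legendreSym l (-7) = 1)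
    (hσ : ∀ s : ZMod l, s ^ 2 = -7 → IsSquare (2 * (s - 21))) (ha8 : a % 8 = 1)
    (ha7 : ¬ IsSquare ((-7 : ℤ) : ZMod a)) (hal : ¬ IsSquare ((a : ℤ) : ZMod l))
    (W : WeierstrassCurve ℚ) [W.IsElliptic] (C : VariableChange ℚ)
    (hC : C • W = cm7.quadraticTwist (((a : ℤ) * l : ℤ) : ℚ)) :
    W.mordellWeilRank = 0 ∧ ∀ c ∈ W.sha, 2 • c = 0 → c = 0 := by
  have hl : l.Prime := Fact.out
  have hap : a.Prime := Fact.out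
  have hM : ((a : ℤ) * l) ≠ 0 := mul_ne_zero (by exact_mod_cast hap.ne_zero) (by exact_mod_cast hl.ne_zero)
  haveI := isElliptic_mk_of_ne_zero (F := ℚ) (hab_posTwist hM)
  have hE := smul_eq_twoTorsionModel_of_smul_eq_quadraticTwist ((a : ℤ) * l) W C hC
  exact rank_eq_zero_and_sha_two_of_smul_eq W _ _ hE
    (rank_eq_zero_and_sha_two_twoTorsionModel_auxTwist_of_symbol_pos hl8 hl7 hσ ha8 ha7 hal)

/-! ## §3. Exhaustiveness of the symbol and the complementarity as one statement -/

/-- **The split symbol is choice-free and two-valued**: for a prime `ℓ ∉ {2, 7}` containing `√−7` and `√7`, either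
`2(s − 21)` is a square for EVERY `s` with `s² = −7`, or for NO such `s` (the two roots `±s` give classes whose product is
`2(s−21)·2(−s−21) = 7·16²`). [folklore] -/
theorem symbol_dichotomy (hl2 : l ≠ 2) (hl7 : l ≠ 7) {s₀ t : ZMod l} (hs₀ : s₀ ^ 2 = -7) (ht : t ^ 2 = 7) :
    (∀ s : ZMod l, s ^ 2 = -7 → IsSquare (2 * (s - 21))) ∨
      (∀ s : ZMod l, s ^ 2 = -7 → ¬ IsSquare (2 * (s - 21))) := by
  have h2F : (2 : ZMod l) ≠ 0 := zmod_two_ne_zero_of_prime_ne_two hl2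
  have h7F : (7 : ZMod l) ≠ 0 := zmod_seven_ne_zero_of_prime_ne_seven hl7
  -- any two roots are `±s₀`, and the classes of `2(s₀ − 21)` and `2(−s₀ − 21)` agree
  have hroots : ∀ s : ZMod l, s ^ 2 = -7 → s = s₀ ∨ s = -s₀ := fun s hs =>
    eq_or_eq_neg_of_sq_eq_sq _ _ (by rw [hs, hs₀])
  obtain ⟨h21, h21'⟩ := sub_ne_zero_and_add_ne_zero_of_sq hs₀ h2F h7F
  have hprod : IsSquare (2 * (s₀ - 21) * (2 * (-s₀ - 21))) :=
    ⟨16 * t, by linear_combination (-4) * hs₀ - 256 * ht⟩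
  have hne : 2 * (s₀ - 21) ≠ 0 := mul_ne_zero h2F h21
  have hne' : 2 * (-s₀ - 21) ≠ 0 := mul_ne_zero h2F (by
    intro h; apply h21'; linear_combination -h)
  have hiff : IsSquare (2 * (-s₀ - 21)) ↔ IsSquare (2 * (s₀ - 21)) := by
    constructor
    · intro h; simpa using isSquare_mul_of_isSquare_mul (x := 1) hne' (by rw [mul_comm]; exact hprod) (by simpa using h)
    · intro h; simpa using isSquare_mul_of_isSquare_mul (x := 1) hne hprod (by simpa using h)
  by_cases hσ : IsSquare (2 * (s₀ - 21))
  · left; intro s hs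
    rcases hroots s hs with rfl | rfl
    · exact hσ
    · exact hiff.mpr hσ
  · right; intro s hs
    rcases hroots s hs with rfl | rfl
    · exact hσ
    · exact fun h => hσ (hiff.mp h)

/-- **COMPLEMENTARITY (first-descent certificate).** For every prime `ℓ ≡ 5 (mod 8)` with `(−7/ℓ) = 1` and every prime
`a ≡ 1 (mod 8)` with `−7 ∉ 𝔽_a²` and `a ∉ 𝔽_ℓ²`: for all models `W₁` of `49a1^{(ℓ)}` and `W₂` of `49a1^{(aℓ)}`,
`(rank W₁ = 0 ∧ Ш(W₁)[2] = 0) ∨ (rank W₂ = 0 ∧ Ш(W₂)[2] = 0)` — the first alternative iff `σ(ℓ) = −1`. (The memo's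
numerics say the other partner then has `(#S,#S') = (4,4)`; that half is not claimed here.)
[cite: SilvermanAEC2009, Thm. X.4.2(a), Prop. X.4.9, III.3.1(b)] -/
theorem rank_eq_zero_and_sha_two_posTwist_or_auxTwist (hl8 : l % 8 = 5) (hl7 : legendreSym l (-7) = 1)
    (ha8 : a % 8 = 1) (ha7 : ¬ IsSquare ((-7 : ℤ) : ZMod a)) (hal : ¬ IsSquare ((a : ℤ) : ZMod l))
    (W₁ : WeierstrassCurve ℚ) [W₁.IsElliptic] (C₁ : VariableChange ℚ) (hC₁ : C₁ • W₁ = cm7.quadraticTwist ((l : ℤ) : ℚ))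
    (W₂ : WeierstrassCurve ℚ) [W₂.IsElliptic] (C₂ : VariableChange ℚ)
    (hC₂ : C₂ • W₂ = cm7.quadraticTwist (((a : ℤ) * l : ℤ) : ℚ)) :
    (W₁.mordellWeilRank = 0 ∧ ∀ c ∈ W₁.sha, 2 • c = 0 → c = 0) ∨
      (W₂.mordellWeilRank = 0 ∧ ∀ c ∈ W₂.sha, 2 • c = 0 → c = 0) := by
  obtain ⟨hl2, hl7', hl4⟩ := prime_ne_two_ne_seven_of_mod_eight_five hl8
  obtain ⟨s, t, hs, ht⟩ := exists_sq_eq_neg_seven_and_sq_eq_seven hl4 hl7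
  rcases symbol_dichotomy hl2 hl7' hs ht with hσ | hσ
  · exact Or.inr (rank_eq_zero_and_sha_two_auxTwist_of_symbol_pos hl8 hl7 hσ ha8 ha7 hal W₂ C₂ hC₂)
  · exact Or.inl (rank_eq_zero_and_sha_two_posTwist_of_symbol_neg hl8 hl7 hσ W₁ C₁ hC₁)

end Partners

end Summit.BirchSwinnertonDyer.BirchSwinnertonDyer.Theorems.GoldfeldGoodTwists

end
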